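import Mathlib
import Summits.Ventures.PercRepro2.CrossAPrimeCoinMarkDebt

/-!
# The coin at a mark, IV: the debt bound from the `c`-free one-measure inequality (E1)
(blind cell PercRepro2, p5 g39; `proofs/subclaims/S4-HARDSTEP.md` §2.4 (s) addendum 50)

Explore the cluster `K = C(a₂)` of the closed-coin law `q = p[e ↦ 0]`, `e = {a₂, o}`.  On `Q`
the cluster `A = C(a₁)` is the cluster of `a₁` in `G ∖ K`, so every mass of the debt bound (D1b)
of `CrossAPrimeCoinMarkDebt` is an expectation of a cluster functional of `K` (the tower identity
`prob_explored_inter_avoid_eq_expect`): with `g = P_{G∖K}(v ∈ A)`, `h = P_{G∖K}(o ∈ A)`,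
`j = P_{G∖K}(o, v ∈ A)`, `s = P_{G∖K}(o ∉ A, v ∈ A) = g − j`, `1 − h = P_{G∖K}(o ∉ A)`
(`delClusterProb`), `1_b = 1[b ∈ K]`, `1_ō = 1[o ∉ K]`,

  `Z₂′ = E[1_ō (1 − h) 1_Q]`, `Zv₂′ = E[1_ō s 1_Q]`, `debt = E[1_b j 1_Q]`, `r₁ = E[1_b 1_ō s 1_Q]`

(`Z2_eq_closed`, `Zv2_eq_closed` — the flip correspondence of the coin, `flip_type2_vL` — then
the tower identity on the explored events `{o ∉ K}`, `{b ∈ K}`; `debt_eq_explored`,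
`r1_eq_explored`).  Under an admissible `c`, `g ≤ c` on the support, hence
`E[1_ō (j − g h) 1_Q] + Zv₂′ ≤ c·Z₂′` (`alpha_add_s_le`, the pointwise identity
`(j − g h) + s = g (1 − h)`, `delClusterProb_compl_o`, `delClusterProb_split_ov`).  So the debt bound (D1b) — and with it `CROSS ≥ 0` and the
open step of the `a₂`-side induction at the mark — follows from the `c`-FREE, ONE-MEASURE
inequality

  **(E1)**  `E[1_ō (1 − h) 1_Q] · E[1_b j 1_Q] ≤ E[1_b 1_Q] · E[1_ō (j − g h) 1_Q] + E[1_Q] · E[1_b 1_ō s 1_Q]`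

(in words: `P_Q(o ∉ K ∪ A) · P_Q(b ∈ K, o, v ∈ A) ≤ P_Q(b ∈ K) · E_Q[1[o ∉ K] · Cov_{G∖K}(o ∈ A, v ∈ A)]
+ P_Q(b ∈ K, o ∉ A, v ∈ A)`; census 0 / 370 exact instances incl. tails, own code):
**`debt_bound_of_E1`**, **`a2Step_coin_mark_of_E1`** (`CROSS ≥ 0` itself is
`cross_nonneg_of_debt_bound` composed with `debt_bound_of_E1`).  (E1) is not
claimed here.  Own work; standard axioms.
-/

namespace Summit.Ventures.PercRepro2

open LeafRowPendantRootSO CrossAPrimeSupport CrossAPrimeA2Route CrossAPrimeA2Induction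
  CrossAPrimeExploredBound CrossAPrimeA2VEdge CrossAPrimeCoinMark CrossAPrimeCoinMarkDebt

namespace CrossAPrimeCoinMarkE1

section Explored

variable {V : Type*} {E : Type*} {ends : E → Sym2 V}

/-- `{b ∈ K}` is an explored event of `a₂`. -/
lemma exploredEvent_connEvent (a₂ b : V) : ExploredEvent ends a₂ (connEvent ends a₂ b) := by
  intro ω ω' hc _
  simp only [connEvent, Set.mem_setOf_eq, ← mem_cluster, hc]

/-- `{o ∉ K}` is an explored event of `a₂`. -/
lemma exploredEvent_connEvent_compl (a₂ o : V) :
    ExploredEvent ends a₂ (connEvent ends a₂ o)ᶜ := by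
  intro ω ω' hc _
  simp only [Set.mem_compl_iff, connEvent, Set.mem_setOf_eq, ← mem_cluster, hc]

end Explored

section Flip

variable {V : Type*} {E : Type*} [DecidableEq E] {ends : E → Sym2 V}

/-- **The flip correspondence for the `v`-mass of type 2**: `ω[e ↦ open] ∈ Q ∩ vL` with `o ∉ K⁰`
iff `ω[e ↦ closed] ∈ Q ∩ vL` with `o ∉ K⁰` and `o ∉ A⁰`. -/
lemma flip_type2_vL {e : E} {a₂ o : V} (hends : ends e = s(a₂, o)) (a₁ v : V) (ω : Config E) :
    (Function.update ω e true ∈ avoidAll ends a₂ {a₁} ∩ connEvent ends a₁ v ∧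
        ¬ Conn ends (Function.update ω e false) a₂ o) ↔
      (Function.update ω e false ∈ avoidAll ends a₂ {a₁} ∩ connEvent ends a₁ v ∧
        ¬ Conn ends (Function.update ω e false) a₂ o ∧
        ¬ Conn ends (Function.update ω e false) a₁ o) := by
  simp only [Set.mem_inter_iff, mem_avoidAll, Finset.mem_singleton, forall_eq, connEvent,
    Set.mem_setOf_eq, conn_flip_iff hends]
  constructor
  · rintro ⟨⟨hQ, hv⟩, ho⟩
    refine ⟨⟨fun h => hQ (Or.inl h), ?_⟩, ho, ?_⟩
    · rcases hv with hv | ⟨h1, -⟩ | ⟨h1, -⟩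
      · exact hv
      · exact absurd (conn_symm h1) (fun h => hQ (Or.inl h))
      · exact absurd (conn_symm h1) (fun h => hQ (Or.inr (Or.inl ⟨conn_refl _ _ _, h⟩)))
    · exact fun h => hQ (Or.inr (Or.inl ⟨conn_refl _ _ _, conn_symm h⟩))
  · rintro ⟨⟨hQ, hv⟩, ho, hao⟩
    refine ⟨⟨?_, Or.inl hv⟩, ho⟩
    rintro (h | ⟨-, h⟩ | ⟨h, -⟩)
    · exact hQ h
    · exact hao (conn_symm h)
    · exact ho h

end Flip

section Closed

variable {V : Type*} {E : Type*} [Fintype E] [DecidableEq E] {R : Type*} [Field R]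
variable {ends : E → Sym2 V}

/-- `Z₂′` as a closed-coin mass: `P¹(Q, type 2) = P⁰(Q, o ∉ K, o ∉ A)`. -/
lemma Z2_eq_closed (p : E → R) {e : E} {a₂ o : V} (hends : ends e = s(a₂, o)) (a₁ : V) :
    prob (Function.update p e 1)
        (avoidAll ends a₂ {a₁} ∩ {ω | o ∉ cluster ends (Function.update ω e false) a₂}) =
      prob (Function.update p e 0)
        ((connEvent ends a₂ o)ᶜ ∩ clusterInEvent ends a₁ {B : Set V | o ∉ B} ∩
          avoidAll ends a₂ {a₁}) := by
  rw [RBRootEdge.prob_update_one_eq, RBRootEdge.prob_update_zero_eq]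
  congr 1
  ext ω
  simp only [Set.mem_setOf_eq, Set.mem_inter_iff, Function.update_idem, mem_cluster,
    Set.mem_compl_iff, mem_clusterInEvent]
  have h := flip_type2_Q hends a₁ ω
  constructor
  · rintro ⟨hQ, ho⟩
    obtain ⟨hQ', ho', hao'⟩ := h.1 ⟨hQ, ho⟩
    exact ⟨⟨ho', hao'⟩, hQ'⟩
  · rintro ⟨⟨ho, hao⟩, hQ⟩
    exact h.2 ⟨hQ, ho, hao⟩

/-- `Zv₂′` as a closed-coin mass: `P¹(Q, vL, type 2) = P⁰(Q, o ∉ K, o ∉ A, v ∈ A)`. -/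
lemma Zv2_eq_closed (p : E → R) {e : E} {a₂ o : V} (hends : ends e = s(a₂, o)) (a₁ v : V) :
    prob (Function.update p e 1)
        ((avoidAll ends a₂ {a₁} ∩ connEvent ends a₁ v) ∩
          {ω | o ∉ cluster ends (Function.update ω e false) a₂}) =
      prob (Function.update p e 0)
        ((connEvent ends a₂ o)ᶜ ∩ clusterInEvent ends a₁ {B : Set V | o ∉ B ∧ v ∈ B} ∩
          avoidAll ends a₂ {a₁}) := by
  rw [RBRootEdge.prob_update_one_eq, RBRootEdge.prob_update_zero_eq]
  congr 1
  ext ω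
  simp only [Set.mem_setOf_eq, Set.mem_inter_iff, Function.update_idem, mem_cluster,
    Set.mem_compl_iff, mem_clusterInEvent]
  have h := flip_type2_vL hends a₁ v ω
  simp only [Set.mem_inter_iff, connEvent, Set.mem_setOf_eq] at h
  constructor
  · rintro ⟨⟨hQ, hv⟩, ho⟩
    obtain ⟨⟨hQ', hv'⟩, ho', hao'⟩ := h.1 ⟨⟨hQ, hv⟩, ho⟩
    exact ⟨⟨ho', hao', hv'⟩, hQ'⟩
  · rintro ⟨⟨ho, hao, hv⟩, hQ⟩
    obtain ⟨⟨hQ', hv'⟩, ho'⟩ := h.2 ⟨⟨hQ, hv⟩, ho, hao⟩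
    exact ⟨⟨hQ', hv'⟩, ho'⟩

/-- The debt as an explored mass: `P⁰(Q, vL, bH, a₁ ↔ o) = P⁰(bH, C(a₁) ∋ o, v, Q)`. -/
lemma debt_eq_explored (q : E → R) (a₁ a₂ o v b : V) :
    prob q ((avoidAll ends a₂ {a₁} ∩ (connEvent ends a₁ v ∩ connEvent ends a₂ b)) ∩
        connEvent ends a₁ o) =
      prob q (connEvent ends a₂ b ∩ clusterInEvent ends a₁ {B : Set V | o ∈ B ∧ v ∈ B} ∩
        avoidAll ends a₂ {a₁}) := by
  congr 1
  ext ω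
  simp only [Set.mem_inter_iff, mem_clusterInEvent, Set.mem_setOf_eq, mem_cluster, connEvent]
  tauto

/-- `r₁` as an explored mass: `P⁰(Q, vL, bH, o ∉ K, o ∉ A) = P⁰(bH, o ∉ K, C(a₁) ∌ o, ∋ v, Q)`. -/
lemma r1_eq_explored (q : E → R) (a₁ a₂ o v b : V) :
    prob q ((avoidAll ends a₂ {a₁} ∩ (connEvent ends a₁ v ∩ connEvent ends a₂ b)) ∩
        (connEvent ends a₂ o)ᶜ ∩ (connEvent ends a₁ o)ᶜ) =
      prob q ((connEvent ends a₂ b ∩ (connEvent ends a₂ o)ᶜ) ∩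
        clusterInEvent ends a₁ {B : Set V | o ∉ B ∧ v ∈ B} ∩ avoidAll ends a₂ {a₁}) := by
  congr 1
  ext ω
  simp only [Set.mem_inter_iff, Set.mem_compl_iff, mem_clusterInEvent, Set.mem_setOf_eq,
    mem_cluster, connEvent]
  tauto

end Closed

section Functionals

variable {V : Type*} {E : Type*} [Fintype E] [DecidableEq E] {R : Type*} [Field R]
variable {ends : E → Sym2 V}

/-- `P_{G∖W}(o ∉ A) = 1 − P_{G∖W}(o ∈ A)`. -/
lemma delClusterProb_compl_o (q : E → R) (a₁ o : V) (W : Set V) :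
    delClusterProb q ends a₁ {B : Set V | o ∉ B} W =
      1 - delClusterProb q ends a₁ {B : Set V | o ∈ B} W := by
  unfold delClusterProb
  have e : {ω : Config E | cluster ends (delConfig ends W ω) a₁ ∈ {B : Set V | o ∉ B}} =
      {ω : Config E | cluster ends (delConfig ends W ω) a₁ ∈ {B : Set V | o ∈ B}}ᶜ := by
    ext ω
    simp
  rw [e, prob_compl]

/-- `P_{G∖W}(o ∉ A, v ∈ A) = P_{G∖W}(v ∈ A) − P_{G∖W}(o, v ∈ A)`. -/
lemma delClusterProb_split_ov (q : E → R) (a₁ o v : V) (W : Set V) :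
    delClusterProb q ends a₁ {B : Set V | o ∉ B ∧ v ∈ B} W =
      delClusterProb q ends a₁ {B : Set V | v ∈ B} W -
        delClusterProb q ends a₁ {B : Set V | o ∈ B ∧ v ∈ B} W := by
  unfold delClusterProb
  have h := prob_inter_add_prob_inter_compl q
    {ω : Config E | cluster ends (delConfig ends W ω) a₁ ∈ {B : Set V | v ∈ B}}
    {ω : Config E | cluster ends (delConfig ends W ω) a₁ ∈ {B : Set V | o ∈ B}}
  have e1 : {ω : Config E | cluster ends (delConfig ends W ω) a₁ ∈ {B : Set V | v ∈ B}} ∩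
      {ω : Config E | cluster ends (delConfig ends W ω) a₁ ∈ {B : Set V | o ∈ B}} =
      {ω : Config E | cluster ends (delConfig ends W ω) a₁ ∈ {B : Set V | o ∈ B ∧ v ∈ B}} := by
    ext ω; simp only [Set.mem_inter_iff, Set.mem_setOf_eq]; tauto
  have e2 : {ω : Config E | cluster ends (delConfig ends W ω) a₁ ∈ {B : Set V | v ∈ B}} ∩
      {ω : Config E | cluster ends (delConfig ends W ω) a₁ ∈ {B : Set V | o ∈ B}}ᶜ =
      {ω : Config E | cluster ends (delConfig ends W ω) a₁ ∈ {B : Set V | o ∉ B ∧ v ∈ B}} := by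
    ext ω; simp only [Set.mem_inter_iff, Set.mem_compl_iff, Set.mem_setOf_eq]; tauto
  rw [e1, e2] at h
  linear_combination h

end Functionals

section Bound

variable {V : Type*} {E : Type*} [Fintype E] [DecidableEq E] [Fintype V] [DecidableEq V]
  {R : Type*} [Field R] [LinearOrder R] [IsStrictOrderedRing R]
variable {ends : E → Sym2 V}

omit [Fintype V] [DecidableEq V] in
/-- **`E[1_ō (j − g h) 1_Q] + E[1_ō s 1_Q] ≤ c · E[1_ō (1 − h) 1_Q]`** under an admissible `c`
(pointwise `(j − g h) + s = g (1 − h)` and `g ≤ c` on `Q`). -/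
lemma alpha_add_s_le {q : E → R} (hq : IsProbVec q) {c : R} {a₁ a₂ v : V}
    (hadm : Adm q c ends a₁ a₂ v) (o : V) :
    expect q (fun ω => ((connEvent ends a₂ o)ᶜ).indicator 1 ω *
          (delClusterProb q ends a₁ {B : Set V | o ∈ B ∧ v ∈ B} (cluster ends ω a₂) -
            delClusterProb q ends a₁ {B : Set V | v ∈ B} (cluster ends ω a₂) *
              delClusterProb q ends a₁ {B : Set V | o ∈ B} (cluster ends ω a₂)) *
          (avoidAll ends a₂ {a₁}).indicator 1 ω) +
        expect q (fun ω => ((connEvent ends a₂ o)ᶜ).indicator 1 ω *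
          delClusterProb q ends a₁ {B : Set V | o ∉ B ∧ v ∈ B} (cluster ends ω a₂) *
          (avoidAll ends a₂ {a₁}).indicator 1 ω) ≤
      c * expect q (fun ω => ((connEvent ends a₂ o)ᶜ).indicator 1 ω *
          delClusterProb q ends a₁ {B : Set V | o ∉ B} (cluster ends ω a₂) *
          (avoidAll ends a₂ {a₁}).indicator 1 ω) := by
  rw [← expect_add, ← expect_const_mul]
  refine expect_mono_supp hq fun ω hω => ?_
  simp only [Pi.add_apply, delClusterProb_split_ov, delClusterProb_compl_o]
  by_cases hQ : ω ∈ avoidAll ends a₂ {a₁}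
  · have hg : delClusterProb q ends a₁ {B : Set V | v ∈ B} (cluster ends ω a₂) ≤ c := by
      have h1 : a₁ ∉ cluster ends ω a₂ := by
        rw [mem_avoidAll] at hQ
        exact fun h => hQ a₁ (Finset.mem_singleton_self a₁) h
      have := hadm (cluster ends ω a₂) (sure_cluster_subset hω a₂) h1
      unfold delClusterProb
      refine le_trans (le_of_eq ?_) this
      rfl
    have hO : 0 ≤ ((connEvent ends a₂ o)ᶜ).indicator (1 : Config E → R) ω :=
      Set.indicator_apply_nonneg fun _ => zero_le_one
    have hh := delClusterProb_le_one q hq ends a₁ {B : Set V | o ∈ B} (cluster ends ω a₂)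
    rw [Set.indicator_of_mem hQ]
    simp only [Pi.one_apply, mul_one]
    have key : ((connEvent ends a₂ o)ᶜ).indicator (1 : Config E → R) ω *
        delClusterProb q ends a₁ {B : Set V | v ∈ B} (cluster ends ω a₂) *
        (1 - delClusterProb q ends a₁ {B : Set V | o ∈ B} (cluster ends ω a₂)) ≤
        ((connEvent ends a₂ o)ᶜ).indicator (1 : Config E → R) ω * c *
        (1 - delClusterProb q ends a₁ {B : Set V | o ∈ B} (cluster ends ω a₂)) := by
      apply mul_le_mul_of_nonneg_right _ (sub_nonneg.2 hh)
      exact mul_le_mul_of_nonneg_left hg hO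
    nlinarith [key]
  · rw [Set.indicator_of_notMem hQ]
    simp

end Bound

section Main

variable {V : Type*} {E : Type*} [Fintype E] [DecidableEq E] [Fintype V] [DecidableEq V]
  {R : Type*} [Field R] [LinearOrder R] [IsStrictOrderedRing R]
variable {ends : E → Sym2 V}

omit [DecidableEq V] in
/-- **The debt bound (D1b) from (E1)**: along the coin `e = {a₂, o}` (random, `c` admissible),
the one-measure inequality (E1) for the closed-coin law `q = p[e ↦ 0]` —
`E[1_ō (1 − h) 1_Q] · E[1_b j 1_Q] ≤ E[1_b 1_Q] · E[1_ō (j − g h) 1_Q] + E[1_Q] · E[1_b 1_ō s 1_Q]`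
— gives `Z₂′ · debt ≤ y⁰ · (c·Z₂′ − Zv₂′) + Z⁰ · yv₂′`. -/
theorem debt_bound_of_E1 {p : E → R} (hp : IsProbVec p) {c : R} {a₁ a₂ v : V}
    (hadm : Adm p c ends a₁ a₂ v) {e : E} {o : V} (hends : ends e = s(a₂, o)) (h1 : p e ≠ 1)
    (b : V)
    (hE1 : expect (Function.update p e 0) (fun ω => ((connEvent ends a₂ o)ᶜ).indicator 1 ω *
            delClusterProb (Function.update p e 0) ends a₁ {B : Set V | o ∉ B}
              (cluster ends ω a₂) * (avoidAll ends a₂ {a₁}).indicator 1 ω) *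
          expect (Function.update p e 0) (fun ω => (connEvent ends a₂ b).indicator 1 ω *
            delClusterProb (Function.update p e 0) ends a₁ {B : Set V | o ∈ B ∧ v ∈ B}
              (cluster ends ω a₂) * (avoidAll ends a₂ {a₁}).indicator 1 ω) ≤
        prob (Function.update p e 0) (avoidAll ends a₂ {a₁} ∩ connEvent ends a₂ b) *
            expect (Function.update p e 0) (fun ω => ((connEvent ends a₂ o)ᶜ).indicator 1 ω *
              (delClusterProb (Function.update p e 0) ends a₁ {B : Set V | o ∈ B ∧ v ∈ B}
                  (cluster ends ω a₂) -
                delClusterProb (Function.update p e 0) ends a₁ {B : Set V | v ∈ B}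
                    (cluster ends ω a₂) *
                  delClusterProb (Function.update p e 0) ends a₁ {B : Set V | o ∈ B}
                    (cluster ends ω a₂)) *
              (avoidAll ends a₂ {a₁}).indicator 1 ω) +
          prob (Function.update p e 0) (avoidAll ends a₂ {a₁}) *
            expect (Function.update p e 0)
              (fun ω => (connEvent ends a₂ b ∩ (connEvent ends a₂ o)ᶜ).indicator 1 ω *
                delClusterProb (Function.update p e 0) ends a₁ {B : Set V | o ∉ B ∧ v ∈ B}
                  (cluster ends ω a₂) * (avoidAll ends a₂ {a₁}).indicator 1 ω)) :
    prob (Function.update p e 1) (avoidAll ends a₂ {a₁} ∩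
          {ω | o ∉ cluster ends (Function.update ω e false) a₂}) *
        prob (Function.update p e 0) ((avoidAll ends a₂ {a₁} ∩
          (connEvent ends a₁ v ∩ connEvent ends a₂ b)) ∩ connEvent ends a₁ o) ≤
      prob (Function.update p e 0) (avoidAll ends a₂ {a₁} ∩ connEvent ends a₂ b) *
          (c * prob (Function.update p e 1) (avoidAll ends a₂ {a₁} ∩
              {ω | o ∉ cluster ends (Function.update ω e false) a₂}) -
            prob (Function.update p e 1) ((avoidAll ends a₂ {a₁} ∩ connEvent ends a₁ v) ∩
              {ω | o ∉ cluster ends (Function.update ω e false) a₂})) +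
        prob (Function.update p e 0) (avoidAll ends a₂ {a₁}) *
          prob (Function.update p e 1)
            ((avoidAll ends a₂ {a₁} ∩ (connEvent ends a₁ v ∩ connEvent ends a₂ b)) ∩
              {ω | o ∉ cluster ends (Function.update ω e false) a₂}) := by
  classical
  have hp0 : IsProbVec (Function.update p e 0) := hp.update e le_rfl zero_le_one
  have hp1 : IsProbVec (Function.update p e 1) := hp.update e zero_le_one le_rfl
  have hadm0 : Adm (Function.update p e 0) c ends a₁ a₂ v :=
    adm_update_zero hadm ⟨a₂, mem_cluster_self ends _ a₂, o, hends⟩ h1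
  -- the four masses as expectations of cluster functionals
  have hZ2 := Z2_eq_closed p hends (ends := ends) a₁
  rw [prob_explored_inter_avoid_eq_expect (Function.update p e 0) ends a₂ a₁
    (Finset.mem_singleton_self a₁) (exploredEvent_connEvent_compl a₂ o)] at hZ2
  have hZv2 := Zv2_eq_closed p hends (ends := ends) a₁ v
  rw [prob_explored_inter_avoid_eq_expect (Function.update p e 0) ends a₂ a₁
    (Finset.mem_singleton_self a₁) (exploredEvent_connEvent_compl a₂ o)] at hZv2
  have hdebt := debt_eq_explored (Function.update p e 0) (ends := ends) a₁ a₂ o v b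
  rw [prob_explored_inter_avoid_eq_expect (Function.update p e 0) ends a₂ a₁
    (Finset.mem_singleton_self a₁) (exploredEvent_connEvent a₂ b)] at hdebt
  have hr1 := r1_eq_explored (Function.update p e 0) (ends := ends) a₁ a₂ o v b
  rw [prob_explored_inter_avoid_eq_expect (Function.update p e 0) ends a₂ a₁
    (Finset.mem_singleton_self a₁)
    (exploredEvent_inter (exploredEvent_connEvent a₂ b) (exploredEvent_connEvent_compl a₂ o))]
    at hr1
  -- `r₁ ≤ yv₂′`
  have hr1le : prob (Function.update p e 0)
      ((avoidAll ends a₂ {a₁} ∩ (connEvent ends a₁ v ∩ connEvent ends a₂ b)) ∩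
        (connEvent ends a₂ o)ᶜ ∩ (connEvent ends a₁ o)ᶜ) ≤
      prob (Function.update p e 1)
        ((avoidAll ends a₂ {a₁} ∩ (connEvent ends a₁ v ∩ connEvent ends a₂ b)) ∩
          {ω | o ∉ cluster ends (Function.update ω e false) a₂}) := by
    rw [← r1_eq p hends a₁ v b]
    exact prob_mono hp1 Set.inter_subset_left
  -- the admissibility step
  have halpha := alpha_add_s_le hp0 hadm0 (ends := ends) o
  -- nonnegativity of `y⁰` and `Z⁰`
  have hy0 := prob_nonneg hp0 (avoidAll ends a₂ {a₁} ∩ connEvent ends a₂ b)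
  have hZ0 := prob_nonneg hp0 (avoidAll ends a₂ {a₁})
  -- assemble
  rw [hZ2, hdebt, hZv2]
  rw [hr1] at hr1le
  have k1 := mul_le_mul_of_nonneg_left (sub_nonneg.2 halpha) hy0
  have k2 := mul_le_mul_of_nonneg_left hr1le hZ0
  nlinarith [hE1, k1, k2]

omit [DecidableEq V] in
/-- **The coin at a mark from (E1)**: under the induction hypothesis `0 ≤ crossC(p⁰; c)` and (E1)
for the closed-coin law, the middle coefficient along `e = {a₂, o}` is nonnegative. -/
theorem a2Step_coin_mark_of_E1 {p : E → R} (hp : IsProbVec p) {c : R} {a₁ a₂ v : V}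
    (hadm : Adm p c ends a₁ a₂ v) {e : E} {o : V} (hends : ends e = s(a₂, o)) (h1 : p e ≠ 1)
    (b : V) (hIH : 0 ≤ crossC (Function.update p e 0) c ends o a₁ a₂ v b)
    (hE1 : expect (Function.update p e 0) (fun ω => ((connEvent ends a₂ o)ᶜ).indicator 1 ω *
            delClusterProb (Function.update p e 0) ends a₁ {B : Set V | o ∉ B}
              (cluster ends ω a₂) * (avoidAll ends a₂ {a₁}).indicator 1 ω) *
          expect (Function.update p e 0) (fun ω => (connEvent ends a₂ b).indicator 1 ω *
            delClusterProb (Function.update p e 0) ends a₁ {B : Set V | o ∈ B ∧ v ∈ B}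
              (cluster ends ω a₂) * (avoidAll ends a₂ {a₁}).indicator 1 ω) ≤
        prob (Function.update p e 0) (avoidAll ends a₂ {a₁} ∩ connEvent ends a₂ b) *
            expect (Function.update p e 0) (fun ω => ((connEvent ends a₂ o)ᶜ).indicator 1 ω *
              (delClusterProb (Function.update p e 0) ends a₁ {B : Set V | o ∈ B ∧ v ∈ B}
                  (cluster ends ω a₂) -
                delClusterProb (Function.update p e 0) ends a₁ {B : Set V | v ∈ B}
                    (cluster ends ω a₂) *
                  delClusterProb (Function.update p e 0) ends a₁ {B : Set V | o ∈ B}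
                    (cluster ends ω a₂)) *
              (avoidAll ends a₂ {a₁}).indicator 1 ω) +
          prob (Function.update p e 0) (avoidAll ends a₂ {a₁}) *
            expect (Function.update p e 0)
              (fun ω => (connEvent ends a₂ b ∩ (connEvent ends a₂ o)ᶜ).indicator 1 ω *
                delClusterProb (Function.update p e 0) ends a₁ {B : Set V | o ∉ B ∧ v ∈ B}
                  (cluster ends ω a₂) * (avoidAll ends a₂ {a₁}).indicator 1 ω)) :
    0 ≤ crossPatC (Function.update p e 0) (Function.update p e 1) c ends o a₁ a₂ v b +
        crossPatC (Function.update p e 1) (Function.update p e 0) c ends o a₁ a₂ v b :=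
  a2Step_coin_mark_of_debt_bound hp hadm hends h1 b hIH (debt_bound_of_E1 hp hadm hends h1 b hE1)

end Main

end CrossAPrimeCoinMarkE1

end Summit.Ventures.PercRepro2
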